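import Summits.ResolutionOfSingularities.ResolutionOfSingularities.Theorems.CurveLeafExitKernels
import Summits.ResolutionOfSingularities.ResolutionOfSingularities.Theorems.MaxContactCutRelativeDeltaCut
import HarnessLib

/-!
# MaxContactCutCurveLeafExit — the decomp-res node «CurveLeafExit» BY NAME on the host route `MaxContactCut`
(lens-2 g13, sha256 cbe610aaf56bd15d; critic row 90 CLEARED)

Tree file 3/3: EXACT AT THE RUNG `rungOne_iff : MaxContactCut.RungOne ⟺ LeafGenericRung ∧ LeafSpecialRung`
(29273), necessity by
letter, the honesty kernel, `closes`, `closes_of_engines`, `closes_of_columns`, `closes_of_leaves`, the MAP EDGES to 28544 and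
30461, and §E the REFINEMENT EDGES to g12's rungs (tree `RelativeDeltaCut.RelGenericRung` / `RelSpecialRung`), the tree asides
32106/32107 (g10), 31576/31577 (g9) and g11's `DeltaGenericRung` / `DeltaSpecialRung` — VERBATIM.
(Sources: CossartJannsenSaito2020; CossartPiltant2019; Moh1987.)
-/

open CategoryTheory AlgebraicGeometry TopologicalSpace IsLocalRing
open Literature.AlgebraicGeometry.Resolution
open Summit.ResolutionOfSingularities.ResolutionOfSingularities.Theorems
open Summit.ResolutionOfSingularities.ResolutionOfSingularities.Theorems.WeakOrderReduction
open Summit.ResolutionOfSingularities.ResolutionOfSingularities.Theorems.DeltaFaceCutClasses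
open Summit.ResolutionOfSingularities.ResolutionOfSingularities.Theorems.RelativeDeltaCut
open Summit.ResolutionOfSingularities.ResolutionOfSingularities.Theses

namespace Summit.ResolutionOfSingularities.ResolutionOfSingularities.Theorems.CurveLeafExit

section Kernels

variable {n : ℕ}

/-- **EXACT AT THE RUNG**: `RungOne ⟺ LeafGenericRung ∧ LeafSpecialRung` (marking by marking). [folklore] -/
theorem rungOne_iff : MaxContactCut.RungOne ↔ LeafGenericRung ∧ LeafSpecialRung := by
  constructor
  · intro h
    exact ⟨fun hE2 n hn => seqLGen_of_seqDimFour_one (h hE2 n hn),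
      fun hE2 n hn => seqLSpec_of_seqDimFour_one (h hE2 n hn)⟩
  · rintro ⟨hG, hS⟩ hE2 n hn
    exact seqDimFour_one_iff.mpr ⟨hG hE2 n hn, hS hE2 n hn⟩

/-- NECESSITY by letter: the decided half is implied by the rung. [folklore] -/
theorem leafGenericRung_of_rungOne (h : MaxContactCut.RungOne) : LeafGenericRung := (rungOne_iff.mp h).1

/-- NECESSITY by letter: the located residual is implied by the rung. [folklore] -/
theorem leafSpecialRung_of_rungOne (h : MaxContactCut.RungOne) : LeafSpecialRung := (rungOne_iff.mp h).2

/-- HONESTY KERNEL: modulo the decided half, the located residual IS the rung. [folklore] -/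
theorem leafSpecialRung_iff_rungOne (hG : LeafGenericRung) : LeafSpecialRung ↔ MaxContactCut.RungOne :=
  ⟨fun hS => rungOne_iff.mpr ⟨hG, hS⟩, leafSpecialRung_of_rungOne⟩

/-- **DECIDING IMPLICATION OF THE NODE**: `MaxContactCut.RungOne` (29273) BY NAME from the two halves. [folklore] -/
theorem closes (hG : LeafGenericRung) (hS : LeafSpecialRung) : MaxContactCut.RungOne :=
  rungOne_iff.mpr ⟨hG, hS⟩

/-- `RungOne` BY NAME from the five ENGINES, the ports and the located residual. [folklore] -/
theorem closes_of_engines (hV : VeryNearCutClasses.VeryNearExit) (hD : DeltaPackageExit)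
    (hU : UniformCurvePackageExit) (hR : RelCurvePackageExit) (hN : NormalConeJumpExit)
    (hP : ∀ n : ℕ, 2 ≤ n → CurvePackagePort n) (h1 : FaceFormCutClasses.OrderOneContact)
    (hS : LeafSpecialRung) : MaxContactCut.RungOne :=
  closes (leafGenericRung_of_engines hV hD hU hR hN hP h1) hS

/-- The located residual split at the rung into the two isolation columns (EXACT). [folklore] -/
theorem leafSpecialRung_iff_iso : LeafSpecialRung ↔
    (E 2 → ∀ n : ℕ, 1 ≤ n → SeqLSpecNonIso n) ∧ (E 2 → ∀ n : ℕ, 1 ≤ n → SeqLSpecIso n) :=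
  ⟨fun h => ⟨fun hE2 n hn => (seqLSpec_iff_iso.mp (h hE2 n hn)).1, fun hE2 n hn => (seqLSpec_iff_iso.mp (h hE2 n hn)).2⟩,
    fun h hE2 n hn => seqLSpec_iff_iso.mpr ⟨h.1 hE2 n hn, h.2 hE2 n hn⟩⟩

/-- `RungOne` BY NAME from the decided half and the two isolation columns. [folklore] -/
theorem closes_of_columns (hG : LeafGenericRung) (hN : E 2 → ∀ n : ℕ, 1 ≤ n → SeqLSpecNonIso n)
    (hI : E 2 → ∀ n : ℕ, 1 ≤ n → SeqLSpecIso n) : MaxContactCut.RungOne :=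
  closes hG (leafSpecialRung_iff_iso.mpr ⟨hN, hI⟩)

/-- The located residual split at the rung into the three LEAVES (CURVE, TANGLE, ISO) — EXACT. [folklore] -/
theorem leafSpecialRung_iff_leaves : LeafSpecialRung ↔
    (E 2 → ∀ n : ℕ, 1 ≤ n → SeqLSpecCurve n) ∧ (E 2 → ∀ n : ℕ, 1 ≤ n → SeqLSpecTangle n) ∧
      (E 2 → ∀ n : ℕ, 1 ≤ n → SeqLSpecIso n) := by
  constructor
  · intro h
    refine ⟨fun hE2 n hn => ?_, fun hE2 n hn => ?_, fun hE2 n hn => (seqLSpec_iff_iso.mp (h hE2 n hn)).2⟩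
    · exact (seqLSpecNonIso_iff.mp (seqLSpec_iff_iso.mp (h hE2 n hn)).1).1
    · exact (seqLSpecNonIso_iff.mp (seqLSpec_iff_iso.mp (h hE2 n hn)).1).2
  · rintro ⟨hC, hT, hI⟩ hE2 n hn
    exact seqLSpec_of_leaves (hC hE2 n hn) (hT hE2 n hn) (hI hE2 n hn)

/-- `RungOne` BY NAME from the decided half and the three leaves. [folklore] -/
theorem closes_of_leaves (hG : LeafGenericRung) (hC : E 2 → ∀ n : ℕ, 1 ≤ n → SeqLSpecCurve n)
    (hT : E 2 → ∀ n : ℕ, 1 ≤ n → SeqLSpecTangle n) (hI : E 2 → ∀ n : ℕ, 1 ≤ n → SeqLSpecIso n) :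
    MaxContactCut.RungOne :=
  closes hG (leafSpecialRung_iff_leaves.mpr ⟨hC, hT, hI⟩)

/-- `E 1` ⟺ the two families at every marking (EXACT, family level). [folklore] -/
theorem e_one_iff_families : E 1 ↔ (∀ n : ℕ, 1 ≤ n → SeqLGen n) ∧ (∀ n : ℕ, 1 ≤ n → SeqLSpec n) :=
  ⟨fun h => ⟨fun n hn => seqLGen_of_seqDimFour_one (h n hn), fun n hn => seqLSpec_of_seqDimFour_one (h n hn)⟩,
    fun h n hn => seqDimFour_one_iff.mpr ⟨h.1 n hn, h.2 n hn⟩⟩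

/-! ### Map edges BY NAME to the tree's located residuals -/

/-- MAP EDGE to the located core `MaxContactCut.StepPICoreDimFour` (28544) BY NAME, through
`MaxContactCutTauLadder.closes`. [folklore] -/
theorem closes_core (h5 : MaxContactCutExhaustion.ContactOrderSequenceDimFour) (r4 : MaxContactCut.RungFour)
    (r3 : MaxContactCut.RungThree) (r2 : MaxContactCut.RungTwo) (hG : LeafGenericRung) (hS : LeafSpecialRung)
    (hSS : MaxContactCut.SequenceToStepAll) : MaxContactCut.StepPICoreDimFour :=
  (MaxContactCutTauLadder.closes h5 r4 r3 r2 (closes hG hS) hSS).2.2.2.2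

/-- MAP EDGE to g7's located residual `MaxContactCut.ClosedPointCoreAll` (30461) BY NAME (the TANGLE / FLAT-δ material
is Round material: given the rounds, the rung IS the closed-point core). [folklore] -/
theorem closes_closedPointCore (hE2 : E 2) (h2 : MaxContactCut.RoundCodimTwoAll)
    (h3 : MaxContactCut.RoundCodimThreeAll) (hG : LeafGenericRung) (hS : LeafSpecialRung) :
    MaxContactCut.ClosedPointCoreAll :=
  (MaxContactCutGenericPointCut.rungOne_iff_core_of_rounds hE2 h2 h3).mp (closes hG hS)

end Kernels

/-! ## §E  Refinement edges BY NAME: to g12 (restated rungs), to the tree's g10 asides 32106/32107, the g9 asides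
31576/31577, and the tree's g11 rungs `DeltaGenericRung` / `DeltaSpecialRung` -/

section Refinement

/-- **EDGE to g12**: the decided half implies g12's decided half `RelGenericRung` (restated). [folklore] -/
theorem relGenericRung_of_leafGenericRung (h : LeafGenericRung) : RelGenericRung :=
  fun hE2 n hn => seqRGen_of_seqLGen (h hE2 n hn)

/-- **EDGE to 32106**: the decided half implies the tree's g10 decided aside `VNGenericRung`. [folklore] -/
theorem vnGenericRung_of_leafGenericRung (h : LeafGenericRung) : MaxContactCut.VNGenericRung :=
  MaxContactCutVeryNearCut.vnGenericRung_iff.mpr fun hE2 n hn => seqNGen_of_seqLGen (h hE2 n hn)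

/-- **EDGE to 31576** (through 32106 and the tree's g10 edge). [folklore] -/
theorem ffGenericRung_of_leafGenericRung (h : LeafGenericRung) : MaxContactCut.FFGenericRung :=
  MaxContactCutVeryNearCut.ffGenericRung_of_vnGenericRung (vnGenericRung_of_leafGenericRung h)

/-- **EDGE to the tree's g11 rung**: the decided half implies `DeltaFaceCutClasses.DeltaGenericRung`. [folklore] -/
theorem deltaGenericRung_of_leafGenericRung (h : LeafGenericRung) : DeltaGenericRung :=
  fun hE2 n hn => seqDGen_of_seqLGen (h hE2 n hn)

/-- **EDGE from g12**: g12's located residual `RelSpecialRung` (restated) implies this node's (the residual SHRINKS by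
letter). [folklore] -/
theorem leafSpecialRung_of_relSpecialRung (h : RelSpecialRung) : LeafSpecialRung :=
  fun hE2 n hn => seqLSpec_of_seqRSpec (h hE2 n hn)

/-- **EDGE from 32107**: the tree's g10 located residual `VNSpecialRung` implies this node's. [folklore] -/
theorem leafSpecialRung_of_vnSpecialRung (h : MaxContactCut.VNSpecialRung) : LeafSpecialRung :=
  fun hE2 n hn => seqLSpec_of_seqNSpec (MaxContactCutVeryNearCut.vnSpecialRung_iff.mp h hE2 n hn)

/-- **EDGE from 31577** (through the tree's g10 edge). [folklore] -/
theorem leafSpecialRung_of_ffSpecialRung (h : MaxContactCut.FFSpecialRung) : LeafSpecialRung :=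
  leafSpecialRung_of_vnSpecialRung (MaxContactCutVeryNearCut.vnSpecialRung_of_ffSpecialRung h)

/-- **EDGE from the tree's g11 rung**: `DeltaFaceCutClasses.DeltaSpecialRung` implies this node's located residual.
[folklore] -/
theorem leafSpecialRung_of_deltaSpecialRung (h : DeltaSpecialRung) : LeafSpecialRung :=
  fun hE2 n hn => seqLSpec_of_seqDSpec (h hE2 n hn)

/-- **EDGE from g12's CURVE stratum** at the rung (the stratum this node cuts). [folklore] -/
theorem leafSpecCurve_of_relSpecCurve (h : E 2 → ∀ n : ℕ, 1 ≤ n → SeqRSpecCurve n) :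
    E 2 → ∀ n : ℕ, 1 ≤ n → SeqLSpecCurve n :=
  fun hE2 n hn => seqLSpecCurve_of_seqRSpecCurve (h hE2 n hn)

/-- **EDGE from g11's NON-ISOLATED column** (tree) at the rung. [folklore] -/
theorem leafSpecNonIso_of_deltaSpecNonIso (h : E 2 → ∀ n : ℕ, 1 ≤ n → SeqDSpecNonIso n) :
    E 2 → ∀ n : ℕ, 1 ≤ n → SeqLSpecNonIso n :=
  fun hE2 n hn => seqLSpecNonIso_of_seqDSpecNonIso (h hE2 n hn)

/-- HONESTY: modulo the decided half, g12's located residual and this node's are EQUIVALENT — both are the rung.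
[folklore] -/
theorem relSpecialRung_iff_leafSpecialRung (hG : LeafGenericRung) : RelSpecialRung ↔ LeafSpecialRung :=
  ⟨leafSpecialRung_of_relSpecialRung,
    fun hS hE2 n hn => by
      intro p hp k _ _ Y g h1 h2 h3 hY h4 I hord hex
      obtain ⟨y, hy, -⟩ := hex
      exact closes hG hS hE2 n hn p hp k Y g h1 h2 h3 hY h4 I hord (fun y _ => Or.inl le_rfl)⟩

/-- HONESTY: modulo the decided half, the tree's g10 located residual 32107 and this node's are EQUIVALENT. [folklore] -/
theorem vnSpecialRung_iff_leafSpecialRung (hG : LeafGenericRung) :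
    MaxContactCut.VNSpecialRung ↔ LeafSpecialRung :=
  ⟨leafSpecialRung_of_vnSpecialRung,
    fun hS => MaxContactCutVeryNearCut.nearSpecialRung_of_rungOne (closes hG hS)⟩

/-- HONESTY: modulo the decided half, the tree's g9 located residual 31577 and this node's are EQUIVALENT. [folklore] -/
theorem ffSpecialRung_iff_leafSpecialRung (hG : LeafGenericRung) :
    MaxContactCut.FFSpecialRung ↔ LeafSpecialRung :=
  ⟨leafSpecialRung_of_ffSpecialRung,
    fun hS => MaxContactCutFaceFormCut.specialRung_of_rungOne (closes hG hS)⟩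

/-- HONESTY: modulo the decided half, the tree's g11 located residual and this node's are EQUIVALENT. [folklore] -/
theorem deltaSpecialRung_iff_leafSpecialRung (hG : LeafGenericRung) : DeltaSpecialRung ↔ LeafSpecialRung :=
  ⟨leafSpecialRung_of_deltaSpecialRung,
    fun hS hE2 n hn => DeltaFaceCutKernels.seqDSpec_of_seqDimFour_one (closes hG hS hE2 n hn)⟩

/-- `RungOne` BY NAME from the decided half and the tree's g10 located residual 32107. [folklore] -/
theorem closes_of_vnSpecialRung (hG : LeafGenericRung) (hS : MaxContactCut.VNSpecialRung) : MaxContactCut.RungOne :=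
  closes hG (leafSpecialRung_of_vnSpecialRung hS)

/-- `RungOne` BY NAME from the decided half and the tree's g9 located residual 31577. [folklore] -/
theorem closes_of_ffSpecialRung (hG : LeafGenericRung) (hS : MaxContactCut.FFSpecialRung) : MaxContactCut.RungOne :=
  closes hG (leafSpecialRung_of_ffSpecialRung hS)

/-- `RungOne` BY NAME from the decided half and the tree's g11 located residual. [folklore] -/
theorem closes_of_deltaSpecialRung (hG : LeafGenericRung) (hS : DeltaSpecialRung) : MaxContactCut.RungOne :=
  closes hG (leafSpecialRung_of_deltaSpecialRung hS)

end Refinement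

end Summit.ResolutionOfSingularities.ResolutionOfSingularities.Theorems.CurveLeafExit
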